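import Mathlib.FieldTheory.AbsoluteGaloisGroup
import Mathlib.Topology.Bases
import Mathlib.Topology.Algebra.Group.TopologicalAbelianization
import Mathlib.GroupTheory.Commutator.Basic
import Literature.AnabelianGeometry.SemiGraphs.TemperedGroups
import Literature.AnabelianGeometry.SemiGraphs.TemperedAnabelian
import HarnessLib

/-!
# The tempered fundamental group of a `p`-adic curve — INTERFACE
# ([SemiAnbd] Example 3.10; [EtTh] §1, the once-punctured elliptic curve)

Mochizuki, *Semi-graphs of anabelioids*, Publ. RIMS **42** (2006), §3 Example 3.10 "Pointed Stable
Curves over p-adic Local Fields I", manuscript pp. 43–45 [cite: MochizukiSemiAnbd2006, Ex 3.10 pp.43-45],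
and Mochizuki, *The étale theta function and its Frobenioid-theoretic manifestations*, Publ. RIMS
**45** (2009), §1, printed pp. 237–239 (kurims manuscript pp. 10–12)
[cite: MochizukiEtTh2009, §1 pp.237-239].

André's tempered fundamental group `π₁^temp(X^log_K)` of a smooth log curve over a finite extension
`K` of `ℚ_p` is NOT constructed in the tree (HOME/plan/FOUNDATIONS.md row 13: BLACKBOX). This file
is the INTERFACE the étale-theta / IUT statements are typed over (cell abc-iut, TRANCHE-T1 P23):
a `structure` whose data are the groups the texts name and whose `Prop` fields are the printed
properties, each quoting its sentence with a page locator. Nothing here is asserted to exist; a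
consumer takes `(D : TemperedArithmeticGroup K)` resp. `(D : OncePuncturedTemperedGroup K)` as a
hypothesis, and a future construction of `π₁^temp` instantiates it.

* `TemperedArithmeticGroup K` — Example 3.10: `Π := π₁^temp(X^log_K)` tempered, the exact sequence
  `1 → Δ → Π → G_K → 1` with `G_K = Gal(K̄/K)` (Mathlib `Field.absoluteGaloisGroup K`),
  `Δ := Ker(Π → G_K)` "the geometric tempered fundamental group" is tempered (p. 43), the
  conclusion of Example 3.10 "both `Δ` and `Π` are temp-slim" (p. 45; temp-slim = `IsSlimGroup`),
  and Galois-countability ([IUTchI] Rmk. 2.5.3 (i) (T1), with (E1)–(E3) — the author's erratum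
  to [SemiAnbd] §3; Mathlib `SecondCountableTopology`); derived: `delta`, `quotientDeltaEquiv`.
  This is the GROUP-level interface; the CURVE-level one, carrying the curve over a `p`-adic field
  `K ⊆ ℚ̄_p` and the profinite completion with its decomposition groups of points, is the §6 file's
  `TemperedCurve p` (cell ruling η), bridged to this structure by `TemperedCurve.toTemperedArithmeticGroup`
  (bridge file).
* (profinite completions are the §6 file's `IsProfiniteCompletion ι`: `Π̂` profinite, `ι` dense,
  the open normal subgroups of finite index of `Π` are exactly the pull-backs of the open normal
  subgroups of `Π̂`.)
* `IsFreeProfiniteOn Π̂ x` — "`Π̂` is a profinite free group on the generators `x`" (universal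
  property towards finite discrete groups).
* `OncePuncturedTemperedGroup K` — [EtTh] §1 pp. 237–238 for `X^log` a stable log curve of type
  `(1,1)` over `O_K` with split singular special fibre: the data above plus the "natural surjection
  `Π^tp_X ↠ Z`" determined by the universal graph-covering of the dual graph of the special fibre
  (p. 238), the profinite completion `Π^tp_X ↪ Π_X := (Π^tp_X)^∧ ↠ G_K` with kernel
  `Δ_X := (Δ^tp_X)^∧` = the closure of the image of `Δ^tp_X` (p. 238), the axiom "`Δ_X` is a
  profinite free group on 2 generators" (p. 238), and the decomposition groups of the cusps (p. 239)
  as a conjugation-stable family of closed subgroups, each mapping onto `G_K`; derived: `deltaHat`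
  (+ `deltaHat_eq_ker_augHat`, `comap_toHat_deltaHat`, normality). Over this data the companion file
  `TemperedThetaQuotients.lean` DEFINES (no axioms) `Π^tp_Y := Ker(Π^tp_X ↠ Z)`, `Δ^tp_Y`, `Δ_X`,
  `Δ^ell_X`, `Δ^Θ_X`, `Δ_Θ` and the tempered quotients `(Π^tp_X)^Θ ↠ (Π^tp_X)^ell`, … (p. 238).
* ORIGIN PREDICATES as the hypothesis structure `TemperedPiOrigin K` (fields
  `IsOfGeometricOrigin`, `IsTateOrigin`): "this data IS the tempered fundamental group of such a
  curve". The structures above are abstract data and the printed results about `π₁^temp` of a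
  curve are false or meaningless for arbitrary data, so they are typed downstream as predicates
  `Foo (Ω : TemperedPiOrigin K) : Prop := ∀ D, Ω.IsOfGeometricOrigin D → …` on a threaded parameter
  `Ω`, assumed and never asserted for all `Ω`: neither dischargeable nor refutable from junk data
  until a construction of `π₁^temp` supplies `Ω` (cell ruling abc-iut-L3-lead 2026-08-25; the tree
  forbids `opaque` constants).

Deliberately NOT here (v1; listed so nothing is silently dropped): the Galois-module identifications
of [EtTh] p. 238 "`1 → Ẑ(1) → Δ^ell_X → Ẑ → 1`", "`∧² Δ^ell_X ≅ Ẑ(1)`", "`Δ_Θ ≅ Ẑ(1)`",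
"`(Δ^tp_Y)^ell ≅ Ẑ(1)`" (they need the cyclotome `Ẑ(1)` as a `G_K`-module; sequel over these names,
proposed fact names `DeltaThetaIsoTate`, `DeltaEllExtension`); the covers `Y_N`, `Z_N` and the
sections attached to cusps (pp. 239–240: the set-up of [EtTh] Prop. 1.1, typed by the [EtTh] §1
file over this interface); the semi-graph of anabelioids `G`, `G^c` of the special fibre and the
quotient `Δ ↠ π₁^temp(G)` of Example 3.10 p. 44, Remark 3.10.1 (pro-`Σ` version) and Corollary 3.11
(companion file on tempered coverings). `K` is only assumed to be a field: the texts take `K/ℚ_p`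
finite, and consumers add the `p`-adic hypotheses they use. No statement of either paper is
strengthened.
-/

open Topology Filter

noncomputable section

namespace Literature.AnabelianGeometry.SemiGraphs

open Literature.AlgebraicGeometry.Frobenioids (IsSlimGroup)

universe u

/-! ### Profinite completions and free profinite groups (vocabulary) -/

section Vocabulary

variable {G : Type u} [Group G] [TopologicalSpace G] {P : Type u} [Group P] [TopologicalSpace P]

/-- `Π̂` is a *free profinite group on the family `x`*: for every finite discrete group `F`, every
family of elements of `F` indexed like `x` is the image of `x` under exactly one continuous
homomorphism `Π̂ → F` — the notion used on [EtTh] PRIMS p. 238, "`Δ_X` is a profinite free group on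
2 generators". (The [EtTh] §1 file's `Literature.AnabelianGeometry.EtaleTheta.IsFreeProfiniteOnTwo`
is the 2-generator case together with the profiniteness conjuncts; it cannot be imported here, the
one-line comparison lives in the bridge file.) [cite: MochizukiEtTh2009, §1 p.238] -/
def IsFreeProfiniteOn {ι : Type*} (P : Type u) [Group P] [TopologicalSpace P] (x : ι → P) : Prop :=
  ∀ (F : Type u) [Group F] [Finite F] [TopologicalSpace F] [DiscreteTopology F] (a : ι → F),
    ∃! f : P →ₜ* F, ∀ i, f (x i) = a i

end Vocabulary

/-! ### Example 3.10: the tempered fundamental group of a smooth log curve over `K` -/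

/-- **[SemiAnbd] Example 3.10** (manuscript p. 43), as an INTERFACE. "Let `K` be a finite extension
of `ℚ_p`; `K̄` an algebraic closure of `K`; `X^log_K` a smooth log curve over `K`. … write
`π₁^temp(X^log_K)` for the tempered fundamental group of [André], §4. Thus, `π₁^temp(X^log_K)` is a
tempered topological group [in the sense of Definition 3.1, (i)] and fits into a natural exact
sequence `1 → π₁^temp(X^log_K̄) → π₁^temp(X^log_K) → G_K → 1` [where `G_K := Gal(K̄/K)` …].
To simplify the notation, let us write `Π := π₁^temp(X^log_K)`; `Δ := π₁^temp(X^log_K̄)`. Note that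
`Δ` is also tempered". The field `aug` is the augmentation `Π → G_K` (Mathlib
`Field.absoluteGaloisGroup K`), `Δ` is its kernel (`TemperedArithmeticGroup.delta`, so the sequence
is exact by construction), and the last two fields record the conclusion of Example 3.10 (p. 45):
"we thus conclude that both `Δ` and `Π` are temp-slim". Nothing asserts that such data exists for
a given curve. [cite: MochizukiSemiAnbd2006, Ex 3.10 pp.43-45] -/
structure TemperedArithmeticGroup (K : Type u) [Field K] : Type (u + 1) where
  /-- the underlying type of `Π := π₁^temp(X^log_K)` -/
  Pi : Type u
  /-- group structure on `Π` -/
  [group : Group Pi]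
  /-- topology on `Π` -/
  [topologicalSpace : TopologicalSpace Pi]
  /-- `Π` is a topological group -/
  [isTopologicalGroup : IsTopologicalGroup Pi]
  /-- "`π₁^temp(X^log_K)` is a tempered topological group [Definition 3.1, (i)]" (p. 43) -/
  isTempered : IsTempered Pi
  /-- the augmentation `Π → G_K` of "the natural exact sequence `1 → Δ → Π → G_K → 1`" (p. 43) -/
  aug : Pi →ₜ* Field.absoluteGaloisGroup K
  /-- exactness at `G_K`: the augmentation is surjective (p. 43) -/
  aug_surjective : Function.Surjective aug
  /-- "Note that `Δ` is also tempered" (p. 43), `Δ := Ker(Π → G_K)` -/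
  isTempered_ker : IsTempered aug.toMonoidHom.ker
  /-- Example 3.10, conclusion (p. 45): "`Π` [is] temp-slim" -/
  isSlimGroup : IsSlimGroup Pi
  /-- Example 3.10, conclusion (p. 45): "`Δ` [is] temp-slim" -/
  isSlimGroup_ker : IsSlimGroup aug.toMonoidHom.ker
  /-- `Π` is *Galois-countable*: "its topology admits a countable basis" ([IUTchI] Rmk. 2.5.3 (i)
  (T1) p. 52; for Example 3.10 this is (E1)–(E3) p. 53 of loc. cit., the author's erratum to
  [SemiAnbd] §3) — Mathlib `SecondCountableTopology`. -/
  secondCountableTopology : SecondCountableTopology Pi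

namespace TemperedArithmeticGroup

attribute [instance] TemperedArithmeticGroup.group TemperedArithmeticGroup.topologicalSpace
  TemperedArithmeticGroup.isTopologicalGroup

variable {K : Type u} [Field K] (D : TemperedArithmeticGroup K)

/-- `Δ := π₁^temp(X^log_K̄) = Ker(Π → G_K)`, "the geometric tempered fundamental group"
([SemiAnbd] Example 3.10 p. 43). [cite: MochizukiSemiAnbd2006, Ex 3.10 p.43] -/
def delta : Subgroup D.Pi := D.aug.toMonoidHom.ker

/-- `Δ` is normal in `Π` (it is a kernel). [cite: MochizukiSemiAnbd2006, Ex 3.10 p.43] -/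
instance delta_normal : D.delta.Normal := by
  unfold delta; infer_instance

/-- Exactness of `1 → Δ → Π → G_K → 1` in the middle: `g ∈ Δ ↔ aug g = 1`.
[cite: MochizukiSemiAnbd2006, Ex 3.10 p.43] -/
theorem mem_delta_iff (g : D.Pi) : g ∈ D.delta ↔ D.aug g = 1 := Iff.rfl

/-- `Π/Δ ≃ G_K` as abstract groups (exactness on the right).
[cite: MochizukiSemiAnbd2006, Ex 3.10 p.43] -/
def quotientDeltaEquiv : D.Pi ⧸ D.delta ≃* Field.absoluteGaloisGroup K :=
  QuotientGroup.quotientKerEquivOfSurjective D.aug.toMonoidHom D.aug_surjective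

end TemperedArithmeticGroup

/-! ### [EtTh] §1: the once-punctured elliptic curve with split singular special fibre -/

/-- **[EtTh] §1, pp. 237–239**, as an INTERFACE extending `TemperedArithmeticGroup`: the tempered
fundamental group `Π^tp_X` of "`X^log` a stable log curve over `S^log` of type `(1,1)`" whose
"special fiber … is singular and split" and whose generic fibre is a smooth log curve (p. 237),
together with:
* `zQuot` — "Since the special fiber of `X` is split, it follows that the universal graph-covering
  of the dual graph of this special fiber determines [up to composition with an element of
  `Aut(Z) = {±1}`] a natural surjection `Π^tp_X ↠ Z` whose kernel, which we denote by `Π^tp_Y`,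
  determines an infinite étale covering `Y^log → X^log`" (p. 238) — recorded as a homomorphism onto
  `Multiplicative ℤ` with open kernel (= continuity for the discrete topology on `Z`);
* "Write `Π_X := (Π^tp_X)^∧`; `Δ_X := (Δ^tp_X)^∧` [where the `∧` denotes the profinite completion]"
  (p. 238): `PiHat`, `toHat` (`IsProfiniteCompletion`, injective), `augHat : Π_X → G_K` extending
  `aug` with kernel `Δ_X = deltaHat` := the closure of the image of `Δ^tp_X`;
* `deltaHat_free` — "`Δ_X` is a profinite free group on 2 generators" (p. 238);
* `cuspDecomp` — the decomposition groups of the cusps of `Y^log` inside `Π^tp_Y` (p. 239: "any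
  decomposition group of a cusp of `Y^log` determines, up to conjugation by `(Δ^tp_Y)^ell`, a
  section `G_K → (Π^tp_Y)^ell` …"), recorded as a nonempty family of closed subgroups of `Π^tp_X`
  contained in `Π^tp_Y`, stable under `Π^tp_X`-conjugation, each mapping ONTO `G_K`.
Nothing asserts that such data exists. [cite: MochizukiEtTh2009, §1 pp.237-239] -/
structure OncePuncturedTemperedGroup (K : Type u) [Field K] extends TemperedArithmeticGroup K where
  /-- the "natural surjection `Π^tp_X ↠ Z`" of p. 238 (well-defined up to `±1`; one choice) -/
  zQuot : Pi →* Multiplicative ℤ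
  /-- it is surjective (p. 238) -/
  zQuot_surjective : Function.Surjective zQuot
  /-- it is continuous for the discrete topology on `Z`: its kernel `Π^tp_Y` is open (p. 238:
  `Π^tp_Y` "determines an infinite étale covering `Y^log → X^log`") -/
  isOpen_ker_zQuot : IsOpen (zQuot.ker : Set Pi)
  /-- the underlying type of the profinite completion `Π_X := (Π^tp_X)^∧` (p. 238 "where the `∧`
  denotes the profinite completion") -/
  PiHat : Type u
  /-- group structure on `Π_X` -/
  [groupHat : Group PiHat]
  /-- topology on `Π_X` -/
  [topologicalSpaceHat : TopologicalSpace PiHat]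
  /-- `Π_X` is a topological group -/
  [isTopologicalGroupHat : IsTopologicalGroup PiHat]
  /-- the completion map `Π^tp_X → Π_X` (p. 238) -/
  toHat : Pi →ₜ* PiHat
  /-- `Π_X` "denotes the profinite completion" of `Π^tp_X` (p. 238) -/
  isProfiniteCompletion_toHat : IsProfiniteCompletion toHat
  /-- `Π^tp_X ↪ Π_X` is injective ([SemiAnbd] Prop. 3.6 (iii) p. 38 "`π₁^temp ↪ π̂₁`") -/
  toHat_injective : Function.Injective toHat
  /-- the profinite augmentation `Π_X → G_K` of "`1 → Δ_X → Π_X → G_K → 1`" ([EtTh] PRIMS p. 238,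
  `Π_X := (Π^tp_X)^∧`, `Δ_X := (Δ^tp_X)^∧`) -/
  augHat : PiHat →ₜ* Field.absoluteGaloisGroup K
  /-- it extends the augmentation of `Π^tp_X` -/
  augHat_comp_toHat : ∀ g : Pi, augHat (toHat g) = aug g
  /-- its kernel is `Δ_X` = the closure of the image of `Δ^tp_X` (p. 238; recorded as an axiom of the
  interface because the completion vocabulary does not force it for abstract data, ref-a A2-F4) -/
  ker_augHat : augHat.toMonoidHom.ker = (aug.toMonoidHom.ker.map toHat.toMonoidHom).topologicalClosure
  /-- "`Δ_X` is a profinite free group on 2 generators" (p. 238), `Δ_X` = closure of the image of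
  `Δ^tp_X = Ker(Π^tp_X → G_K)` in `Π_X` (`= deltaHat = Ker(Π_X → G_K)`) -/
  deltaHat_free : ∃ x : Fin 2 → ((aug.toMonoidHom.ker.map toHat.toMonoidHom).topologicalClosure),
    IsFreeProfiniteOn _ x
  /-- the decomposition groups of the cusps of `Y^log` (p. 239), a family of subgroups of `Π^tp_X` -/
  cuspDecomp : Set (Subgroup Pi)
  /-- there is a cusp (type `(1,1)`: one cusp on `X`, a `Z`-torsor of cusps on `Y`) -/
  cuspDecomp_nonempty : cuspDecomp.Nonempty
  /-- decomposition groups are closed subgroups -/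
  isClosed_of_mem_cuspDecomp : ∀ D ∈ cuspDecomp, IsClosed (D : Set Pi)
  /-- decomposition groups of cusps of `Y` lie in `Π^tp_Y` -/
  le_ker_of_mem_cuspDecomp : ∀ D ∈ cuspDecomp, D ≤ zQuot.ker
  /-- the family is stable under conjugation by `Π^tp_X` (decomposition groups are defined up to
  conjugation; `Π^tp_X` permutes the cusps of `Y`) -/
  conj_mem_cuspDecomp : ∀ D ∈ cuspDecomp, ∀ g : Pi, D.map (MulAut.conj g).toMonoidHom ∈ cuspDecomp
  /-- each decomposition group maps ONTO `G_K` (p. 239: "any decomposition group of a cusp of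
  `Y^log` determines, up to conjugation by `(Δ^tp_Y)^ell`, a section `G_K → (Π^tp_Y)^ell` of the
  natural surjection `(Π^tp_Y)^ell ↠ G_K`" — a section over all of `G_K`, the cusps being
  `K`-rational; the open subgroup `G_{K_N}` of loc. cit. enters only the restriction clause) -/
  map_aug_eq_top_of_mem_cuspDecomp : ∀ D ∈ cuspDecomp,
    (D.map aug.toMonoidHom : Subgroup (Field.absoluteGaloisGroup K)) = ⊤

namespace OncePuncturedTemperedGroup

attribute [instance] OncePuncturedTemperedGroup.groupHat
  OncePuncturedTemperedGroup.topologicalSpaceHat OncePuncturedTemperedGroup.isTopologicalGroupHat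

variable {K : Type u} [Field K] (D : OncePuncturedTemperedGroup K)

/-- `Δ̂ := (Δ)^∧`, realised as the closure of the image of `Δ` in the profinite completion `Π̂`
([EtTh] PRIMS p. 238 "`Δ_X := (Δ^tp_X)^∧`"). [cite: MochizukiEtTh2009, §1 p.238] -/
def deltaHat : Subgroup D.PiHat := (D.delta.map D.toHat.toMonoidHom).topologicalClosure

/-- `Δ̂` is a closed subgroup of `Π̂`. [cite: MochizukiEtTh2009, §1 p.238] -/
theorem isClosed_deltaHat : IsClosed (D.deltaHat : Set D.PiHat) :=
  Subgroup.isClosed_topologicalClosure _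

/-- `Δ̂ = Ker(Π̂ → G_K)` (the interface axiom `ker_augHat` re-read): "`1 → Δ_X → Π_X → G_K → 1`".
[cite: MochizukiEtTh2009, §1 p.238] -/
theorem deltaHat_eq_ker_augHat : D.deltaHat = D.augHat.toMonoidHom.ker := D.ker_augHat.symm

/-- `Δ̂` is normal in `Π̂` (a kernel). [cite: MochizukiEtTh2009, §1 p.238] -/
instance deltaHat_normal : D.deltaHat.Normal := by
  rw [deltaHat_eq_ker_augHat]; infer_instance

/-- The trace of `Δ̂` on `Π` is `Δ`: `toHat⁻¹(Δ̂) = Δ`. [cite: MochizukiEtTh2009, §1 p.238] -/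
theorem comap_toHat_deltaHat : D.deltaHat.comap D.toHat.toMonoidHom = D.delta := by
  ext g
  rw [Subgroup.mem_comap, deltaHat_eq_ker_augHat, MonoidHom.mem_ker,
    TemperedArithmeticGroup.mem_delta_iff]
  change D.augHat (D.toHat g) = 1 ↔ D.aug g = 1
  rw [D.augHat_comp_toHat g]

/-- Conjugation by an element of the image of `Π` preserves `Δ̂`. [cite: MochizukiEtTh2009, §1 p.238] -/
theorem conj_toHat_mem_deltaHat (g : D.Pi) {h : D.PiHat} (hh : h ∈ D.deltaHat) :
    D.toHat g * h * (D.toHat g)⁻¹ ∈ D.deltaHat :=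
  D.deltaHat_normal.conj_mem h hh (D.toHat g)


end OncePuncturedTemperedGroup

/-! ### Origin predicates as a hypothesis structure (BLACKBOX) -/

/-- ORIGIN PREDICATES, as a HYPOTHESIS STRUCTURE (the tree forbids uninterpreted constants):
`TemperedArithmeticGroup K` / `OncePuncturedTemperedGroup K` are abstract data, while the printed
results ([SemiAnbd] Ex. 3.10, Cor. 3.11, §6; [EtTh] §1) concern THE tempered fundamental group of
a curve and are false or meaningless for arbitrary data with these axioms. Since André's `π₁^temp`
([SemiAnbd] Ex. 3.10 p. 43: "the tempered fundamental group of [André], §4") is not constructed in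
the tree (FOUNDATIONS row 13), "`D` is `π₁^temp(X^log_K)` of a smooth log curve over `K`"
(`IsOfGeometricOrigin`) and "`D` is `Π^tp_X` of the once-punctured elliptic curve with split
multiplicative reduction of [EtTh] §1 p. 237" (`IsTateOrigin`) are carried by a parameter
`Ω : TemperedPiOrigin K` that every consumer threads as a section variable; each such printed result
is typed as a predicate `Foo (Ω : TemperedPiOrigin K) : Prop := ∀ D, Ω.IsOfGeometricOrigin D → …`
and ASSUMED (`(h : Foo Ω)`), never asserted for all `Ω` — so it can be neither discharged nor refuted
from junk data until a construction of `π₁^temp` supplies the intended `Ω`.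
[cite: MochizukiSemiAnbd2006, Ex 3.10 p.43] -/
structure TemperedPiOrigin (K : Type u) [Field K] : Type (u + 1) where
  /-- "`D` is `π₁^temp(X^log_K) ↠ G_K` for some smooth log (orbi)curve `X^log_K` over `K`"
  ([SemiAnbd] Ex. 3.10 p. 43) -/
  IsOfGeometricOrigin : TemperedArithmeticGroup K → Prop
  /-- "`D` is `Π^tp_X` with its surjection onto `Z`, profinite completion and cusp data, for the
  stable log curve `X^log` of type `(1,1)` with split singular special fibre of [EtTh] §1 p. 237" -/
  IsTateOrigin : OncePuncturedTemperedGroup K → Prop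
  /-- the once-punctured case is a special case of the general one -/
  isOfGeometricOrigin_of_isTateOrigin : ∀ D : OncePuncturedTemperedGroup K,
    IsTateOrigin D → IsOfGeometricOrigin D.toTemperedArithmeticGroup

end Literature.AnabelianGeometry.SemiGraphs

end
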